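/-
Copyright (c) 2026 the pub-hodgecm-mathlib formalisation cell (harness21).  Prover seat hodgecm-mathlib-F0P2-p02 (g13): road «S3-ram» (LEAD F0P3a-plan (g12); architect
A-p16 (g31); owner F0P3a-p06 (g15)), organ G1 «ROOTED-TREE DESCENDANT PARTITION» of F0P3a-p01 (g16)'s BLUEPRINT (a2)(B) «TREE INDUCTION» v1 899adc41 §2 (B3) ∕ §3; 2026-09-01.
-/
import Literature.Combinatorics.SimpleGraph.TreeRetractionGate        -- ★ `height_iterate_parent`, `exists_walk_iterate_parent` (the `(h, p)` retraction currency; F0P2-p06 (g10))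
import Literature.Combinatorics.SimpleGraph.TreeSubtreeLayerCount     -- ★ `parent_eq_of_adj_of_height`, `connected_induce_singleton`, `height_eq_dist_of_singleton` (F0P3a-p08 (g17))
import Mathlib.Algebra.BigOperators.Finprod                          -- `∑ᶠ` (the instance-free spellings)
import HarnessLib

/-!
# Descendant cones in a rooted tree: `Desc(v) = {v} ⊔ ⨆_{c child of v} Desc(c)` and the counting form `#(Desc v ∩ S) = [v ∈ S] + Σ_c #(Desc c ∩ S)`
# (Serre, *Trees* I.2.3; Diestel Thm. 1.5.1)

Topic `Combinatorics/SimpleGraph`; namespace `Literature.Combinatorics.SimpleGraph.TreeLayers` (family of ★ `TreeSubtreeLayerCount` ∕ `TreeHereditaryLayerCount` ∕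
`TreeRetractionGate`).  THEOREMS ONLY (no definition, no instance, no notation, no named fact, no `sorry`); Mathlib + the two ★ imports; arbitrary vertex type.
Cell `pub/hodgecm-mathlib`, F0∕P3a, crux H413 = `stmt-HodgeConjecture-24833`, road «S3-ram» (Literature seeding, no books consequence): organ **G1 (B3) «generic
rooted-tree descendant partition»** of F0P3a-p01 (g16)'s BLUEPRINT (a2)(B) — the bookkeeping on which the tree induction (G5) for the fixed-lattice counts of the
ramified `U(2,1)` tree runs.  Written by F0P2-p02 (g13) as a GENERIC organ (pure graph theory).  HONEST LABEL: HC_CM is proved only modulo the 2 remaining named inputs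
(hLiu418 24832, h413 24833) until rung 0 closes; nothing about unitary groups is asserted here.

THE MATHEMATICS ([Serre1980Trees] I.2.3).  `(h, p)` height∕parent data toward `Y ⊆ V` — used only through the clauses (P1) `h v = 0 ↔ v ∈ Y`, (P2) `v ∉ Y ⇒ v ~ p v ∧
h (p v) + 1 = h v`, (P5) `v ∉ Y ⇒` every neighbour `w ≠ p v` has `h w = h v + 1 ∧ p w = v` and (dist) `h v = dist(v, Y)` (attained) of ★ `TreeRetraction.exists_retraction`,
taken as HYPOTHESES (as in the sibling files).  The CONE (set of DESCENDANTS) of a vertex `v` is `{w | h v ≤ h w ∧ p^[h w − h v] w = v}` (no definition is introduced: the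
statements spell the set); for `y ∈ Y` it is the cone `{w | p^[h w] w = y}` of ★ `TreeRetractionGate` §3.  The CHILDREN of `v` are its neighbours one level up,
`{c | v ~ c ∧ h c = h v + 1}` (then `p c = v`; Finset spelling `(G.neighborFinset v).filter (h · = h v + 1)` as in ★ `TreeSubtreeLayerCount`).
* §1 (any graph): `mem_cone_self`, `not_mem_cone_of_height_lt`, `cone_subset_cone_of_mem_cone` (transitivity), `disjoint_cone_of_height_eq_of_ne`,
  `mem_cone_iff_parent_mem_cone` (`w ≠ v`: `w ∈ Desc v ↔ h v < h w ∧ p w ∈ Desc v`), `parent_eq_of_adj_of_height_succ` ∕ `mem_cone_of_parent_eq` (children),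
  **`cone_eq_insert_biUnion_cone_children`** — (i) `Desc(v) = {v} ∪ ⋃_{c child} Desc(c)`, with `not_mem_cone_child` and `pairwiseDisjoint_cone_children` (the union is DISJOINT);
  `iterate_parent_mem_of_parentClosed` ∕ `cone_inter_eq_empty_of_not_mem_of_parentClosed` (a parent-closed `F` missing `c` misses `Desc c`).
* §2 INSTANCE-FREE core **`ncard_cone_inter_eq_add_sum_finset`** — (ii) for ANY `S ⊆ V` with `Desc v ∩ S` finite and any Finset `s` of children covering those whose cone
  meets `S`: `#(Desc v ∩ S) = [v ∈ S] + Σ_{c ∈ s} #(Desc c ∩ S)`; **`ncard_cone_inter_eq_add_sum_finset_of_parentClosed`** ∕ **`…_add_finsum_of_parentClosed`** — for a finite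
  parent-closed `F` and any predicate `P`: `#(Desc v ∩ F ∩ P) = [v ∈ F ∧ P v] + Σ_{c child, c ∈ F} #(Desc c ∩ F ∩ P)` (BLUEPRINT (B3)(ii) verbatim; Finset `s` with `c ∈ s ↔ …`
  in the ★ `exists_finset_layer_succ` style, or `∑ᶠ c ∈ {children} ∩ F`; only `F.Finite` assumed); locally finite spellings `ncard_cone_inter_eq_add_sum{,_of_parentClosed}`
  over `(G.neighborFinset v).filter …`.
* §3 (`G` connected, (dist)) `height_le_height_add_dist` (`h` is 1-Lipschitz), **`mem_cone_iff_height_eq_add_dist`** — `w ∈ Desc v ↔ h w = h v + dist(v, w)`: the cone IS the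
  geodesic shadow (every geodesic from `w` down to level `h v` ends at `v`).
* §4 ROOTED INTRINSIC FORMS for a tree `G` and a root `r` (`Y = {r}`, `h = dist(r, ·)`; BLUEPRINT notation `Desc(v) = {w | dist(r,w) = dist(r,v) + dist(v,w)}`, children
  `{c ~ v | dist(r,c) = dist(r,v) + 1}`): `exists_rooted_parent` (a parent map `p` with (P2)(P5) in `dist(r, ·)` and `Desc(v) = {w | dist(r,v) ≤ dist(r,w) ∧ p^[…] w = v}`),
  **`setOf_dist_eq_add_dist_eq_insert_biUnion`** (i), `not_mem_setOf_dist_child`, `disjoint_setOf_dist_of_ne` (disjointness), `setOf_dist_subset_of_mem` (transitivity),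
  INSTANCE-FREE (only `F.Finite` + parent-closed): **`ncard_setOf_dist_inter_eq_add_sum_finset_of_parentClosed`** (Finset `s`, `c ∈ s ↔ …`),
  **`ncard_setOf_dist_inter_eq_add_finsum_of_parentClosed`** (`∑ᶠ`), **`ncard_setOf_dist_inter_eq_add_finsum_finsum_of_parentClosed`** ∕ `…_add_sum_sum_finset_of_parentClosed`
  (two steps to the GRANDCHILDREN under `¬ P` on the children — the bipartite use, where the odd layer carries no stratum), **`parentClosed_fixedPoints`** (the fixed set of a
  root-fixing automorphism is parent-closed — the `hF` of the application `F = Fix γ`); locally finite spellings `ncard_setOf_dist_inter_eq_add_sum{,_of_parentClosed,_sum}`.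
* §5 (ED. 2) conveniences for the induction: `setOf_dist_eq_add_dist_root` (`Desc r = V`), **`ncard_inter_eq_add_finsum_root_of_parentClosed`** (the count at the ROOT),
  `ncard_setOf_dist_inter_eq_ite_of_forall_child_not_mem` (LEAVES of `F`), **`card_filter_dist_eq_add_sum_card_filter_of_parentClosed`** (the `Finset.filter`-card spelling of (B3)(ii)),
  `mem_of_mem_setOf_dist_of_parentClosed` ∕ `parentClosed_of_ancestorClosed` (parent-closed ⟺ ancestor-closed), `iso_apply_eq_self_of_mem_setOf_dist` (`Fix φ` is ancestor-closed).
* §6 (ED. 3, J3) TRANSPORT ALONG `φ : G ≃g G′`: `dist_iso_apply` (isometry), `image_setOf_dist_eq_add_dist` ∕ `iso_apply_mem_setOf_dist_iff` (descendant sets), `image_setOf_adj_and_dist_eq`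
  (children), `ncard_image_iso`, `image_setOf_apply_eq_self` ∕ `conj_apply_eq_self_of_apply_eq_self` (fixed sets of conjugate automorphisms), `parentClosed_image_iso`, `finite_image_iso_iff`,
  **`ncard_setOf_dist_inter_image_eq`** ∕ **`ncard_setOf_dist_inter_image_inter_eq`** (the counts of (B3)(ii) are the same in `G` and `G′`).

## References
* [Serre1980Trees] J.-P. Serre, *Trees*, Springer (1980): I.2.3 (projection onto a subtree; every geodesic into the subtree passes through the projection), I.6.4 Prop. 24, II.1.1.
* [Diestel2010] R. Diestel, *Graph Theory*, 4th ed., Thm. 1.5.1 (unique paths in trees), Prop. 1.5.2 (normal ∕ rooted trees: tree-order, up-closure).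
-/

set_option autoImplicit false

open SimpleGraph Finset

namespace Literature.Combinatorics.SimpleGraph.TreeLayers

variable {V : Type*} {G : SimpleGraph V}

/-- The `ncard` of a finite pairwise-disjoint union indexed by a finset is the sum of the `ncard`s (folklore bookkeeping). [cite: Serre1980Trees, I.2.3] -/
private theorem ncard_biUnion_finset_eq_sum_of_disjoint {ι α : Type*} [DecidableEq ι] (I : Finset ι) (S : ι → Set α)
    (hfin : ∀ i ∈ I, (S i).Finite) (hdisj : ∀ i ∈ I, ∀ j ∈ I, i ≠ j → Disjoint (S i) (S j)) :
    (⋃ i ∈ I, S i).ncard = ∑ i ∈ I, (S i).ncard := by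
  induction I using Finset.induction_on with
  | empty => simp
  | insert a I haI ih =>
    have hfin' : ∀ i ∈ I, (S i).Finite := fun i hi => hfin i (Finset.mem_insert_of_mem hi)
    have hdisj' : ∀ i ∈ I, ∀ j ∈ I, i ≠ j → Disjoint (S i) (S j) := fun i hi j hj =>
      hdisj i (Finset.mem_insert_of_mem hi) j (Finset.mem_insert_of_mem hj)
    rw [Finset.set_biUnion_insert, Finset.sum_insert haI, ← ih hfin' hdisj']
    refine Set.ncard_union_eq ?_ (hfin a (Finset.mem_insert_self a I)) (Set.Finite.biUnion I.finite_toSet hfin')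
    rw [Set.disjoint_iUnion₂_right]
    exact fun i hi => hdisj a (Finset.mem_insert_self a I) i (Finset.mem_insert_of_mem hi) (fun h => haI (h ▸ hi))

section Cone

variable {Y : Set V} {h : V → ℕ} {p : V → V}
  (h0 : ∀ v, h v = 0 ↔ v ∈ Y) (hpar : ∀ v, v ∉ Y → G.Adj v (p v) ∧ h (p v) + 1 = h v)
  (hchild : ∀ v w, v ∉ Y → G.Adj v w → w ≠ p v → h w = h v + 1 ∧ p w = v)

/-! ## §1 The cone `{w | h v ≤ h w ∧ p^[h w - h v] w = v}` of descendants of a vertex, its children, and the partition -/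

/-- Every vertex is its own descendant: `v ∈ Desc v`. [cite: Serre1980Trees, I.2.3] -/
theorem mem_cone_self (v : V) : v ∈ {w | h v ≤ h w ∧ p^[h w - h v] w = v} :=
  ⟨le_rfl, by rw [Nat.sub_self, Function.iterate_zero_apply]⟩

/-- A vertex strictly below the level of `v` is not a descendant of `v`. [cite: Serre1980Trees, I.2.3] -/
theorem not_mem_cone_of_height_lt {v w : V} (hw : h w < h v) : w ∉ {w | h v ≤ h w ∧ p^[h w - h v] w = v} :=
  fun hmem => absurd hmem.1 (not_le.2 hw)

/-- **Transitivity**: the descendants of a descendant `u` of `v` are descendants of `v` (`p^[a + b] = p^[a] ∘ p^[b]`). [cite: Serre1980Trees, I.2.3] -/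
theorem cone_subset_cone_of_mem_cone {u v : V} (hu : u ∈ {w | h v ≤ h w ∧ p^[h w - h v] w = v}) :
    {w | h u ≤ h w ∧ p^[h w - h u] w = u} ⊆ {w | h v ≤ h w ∧ p^[h w - h v] w = v} := by
  rintro w ⟨huw, hw⟩
  obtain ⟨hvu, hu⟩ := hu
  refine ⟨hvu.trans huw, ?_⟩
  show p^[h w - h v] w = v
  have heq : h w - h v = (h u - h v) + (h w - h u) := by omega
  rw [heq, Function.iterate_add_apply, hw, hu]

/-- **Two cones rooted at distinct vertices of the same level are disjoint** (a descendant determines its ancestor at each level). [cite: Serre1980Trees, I.2.3] -/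
theorem disjoint_cone_of_height_eq_of_ne {c c' : V} (hcc : h c = h c') (hne : c ≠ c') :
    Disjoint {w | h c ≤ h w ∧ p^[h w - h c] w = c} {w | h c' ≤ h w ∧ p^[h w - h c'] w = c'} := by
  rw [Set.disjoint_left]
  rintro w ⟨-, hw⟩ ⟨-, hw'⟩
  have hw'' : p^[h w - h c'] w = c := by rw [← hcc]; exact hw
  exact hne (hw''.symm.trans hw')

include h0 hpar in
/-- **Recursion through the parent**: for `w ≠ v`, `w ∈ Desc v ↔ h v < h w ∧ p w ∈ Desc v`. [cite: Serre1980Trees, I.2.3] -/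
theorem mem_cone_iff_parent_mem_cone {v w : V} (hne : w ≠ v) :
    w ∈ {w | h v ≤ h w ∧ p^[h w - h v] w = v} ↔ h v < h w ∧ p w ∈ {w | h v ≤ h w ∧ p^[h w - h v] w = v} := by
  constructor
  · rintro ⟨hvw, hw⟩
    have hlt : h v < h w := by
      rcases hvw.eq_or_lt with heq | hlt
      · rw [heq, Nat.sub_self, Function.iterate_zero_apply] at hw
        exact absurd hw hne
      · exact hlt
    have hwY : w ∉ Y := fun hmem => by have := (h0 w).2 hmem; omega
    have hhp := (hpar w hwY).2
    refine ⟨hlt, ?_, ?_⟩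
    · show h v ≤ h (p w)
      omega
    · show p^[h (p w) - h v] (p w) = v
      have heq : h w - h v = (h (p w) - h v) + 1 := by omega
      rw [heq, Function.iterate_succ_apply] at hw
      exact hw
  · rintro ⟨hlt, -, hp⟩
    have hwY : w ∉ Y := fun hmem => by have := (h0 w).2 hmem; omega
    have hhp := (hpar w hwY).2
    refine ⟨hlt.le, ?_⟩
    show p^[h w - h v] w = v
    have heq : h w - h v = (h (p w) - h v) + 1 := by omega
    rw [heq, Function.iterate_succ_apply]
    exact hp

include h0 hchild in
/-- **A neighbour one level up is a child**: if `v ~ c` and `h c = h v + 1` then `p c = v` (uniqueness of the down-neighbour, ★ `parent_eq_of_adj_of_height`).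
[cite: Serre1980Trees, I.2.3] -/
theorem parent_eq_of_adj_of_height_succ {v c : V} (hadj : G.Adj v c) (hc : h c = h v + 1) : p c = v :=
  parent_eq_of_adj_of_height hchild (fun hmem => by have := (h0 c).2 hmem; omega) hadj.symm hc

include hpar in
/-- A vertex `c ∉ Y` is a descendant of its parent: `c ∈ Desc (p c)`. [cite: Serre1980Trees, I.2.3] -/
theorem mem_cone_of_parent_eq {v c : V} (hcY : c ∉ Y) (hpc : p c = v) : c ∈ {w | h v ≤ h w ∧ p^[h w - h v] w = v} := by
  have hh := (hpar c hcY).2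
  rw [hpc] at hh
  refine ⟨by omega, ?_⟩
  show p^[h c - h v] c = v
  have heq : h c - h v = 1 := by omega
  rw [heq, Function.iterate_one, hpc]

include h0 hpar hchild in
/-- **(i) THE DESCENDANT PARTITION.**  `Desc(v) = {v} ∪ ⋃_{c child of v} Desc(c)`, the children being the neighbours `c` of `v` with `h c = h v + 1`; the pieces are pairwise
disjoint (`not_mem_cone_child`, `pairwiseDisjoint_cone_children`).  For `w ∈ Desc v`, `w ≠ v`, the child on the way is `p^[h w − h v − 1] w`. [cite: Serre1980Trees, I.2.3]
[cite: Diestel2010, Prop. 1.5.2] -/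
theorem cone_eq_insert_biUnion_cone_children (v : V) :
    {w | h v ≤ h w ∧ p^[h w - h v] w = v} = insert v (⋃ c ∈ {c | G.Adj v c ∧ h c = h v + 1}, {w | h c ≤ h w ∧ p^[h w - h c] w = c}) := by
  ext w
  rw [Set.mem_insert_iff, Set.mem_iUnion₂]
  constructor
  · rintro ⟨hvw, hw⟩
    by_cases hne : w = v
    · exact Or.inl hne
    right
    have hlt : h v < h w := by
      rcases hvw.eq_or_lt with heq | hlt
      · rw [heq, Nat.sub_self, Function.iterate_zero_apply] at hw
        exact absurd hw hne
      · exact hlt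
    -- the child on the way down
    have hc : h (p^[h w - h v - 1] w) = h v + 1 := by
      have := height_iterate_parent h0 hpar w (h w - h v - 1) (by omega)
      omega
    have hcY : p^[h w - h v - 1] w ∉ Y := fun hmem => by have := (h0 _).2 hmem; omega
    have hpc : p (p^[h w - h v - 1] w) = v := by
      rw [← Function.iterate_succ_apply' p (h w - h v - 1) w]
      have heq : (h w - h v - 1).succ = h w - h v := by omega
      rw [heq]
      exact hw
    refine ⟨p^[h w - h v - 1] w, ⟨?_, hc⟩, ?_⟩
    · have hadj := (hpar _ hcY).1
      rw [hpc] at hadj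
      exact hadj.symm
    · refine ⟨by omega, ?_⟩
      show p^[h w - h (p^[h w - h v - 1] w)] w = p^[h w - h v - 1] w
      rw [hc]
      have heq : h w - (h v + 1) = h w - h v - 1 := by omega
      rw [heq]
  · rintro (rfl | ⟨c, ⟨hadj, hc⟩, hw⟩)
    · exact mem_cone_self w
    · have hcY : c ∉ Y := fun hmem => by have := (h0 c).2 hmem; omega
      exact cone_subset_cone_of_mem_cone (mem_cone_of_parent_eq hpar hcY (parent_eq_of_adj_of_height_succ h0 hchild hadj hc)) hw

/-- The vertex `v` itself lies in no child's cone. [cite: Serre1980Trees, I.2.3] -/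
theorem not_mem_cone_child {v c : V} (hc : h c = h v + 1) : v ∉ {w | h c ≤ h w ∧ p^[h w - h c] w = c} :=
  not_mem_cone_of_height_lt (by omega)

/-- The cones of the children of `v` are pairwise disjoint. [cite: Serre1980Trees, I.2.3] -/
theorem pairwiseDisjoint_cone_children (v : V) :
    {c | G.Adj v c ∧ h c = h v + 1}.PairwiseDisjoint (fun c => {w | h c ≤ h w ∧ p^[h w - h c] w = c}) :=
  fun _ hc _ hc' hne => disjoint_cone_of_height_eq_of_ne (hc.2.trans hc'.2.symm) hne

include h0 hpar in
/-- **Ancestors of a member of a parent-closed set lie in it**: if `F` is closed under `p` off `Y` and `w ∈ F`, then `p^[k] w ∈ F` for all `k ≤ h w`.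
[cite: Diestel2010, Prop. 1.5.2] -/
theorem iterate_parent_mem_of_parentClosed {F : Set V} (hF : ∀ w ∈ F, w ∉ Y → p w ∈ F) {w : V} (hw : w ∈ F) :
    ∀ k, k ≤ h w → p^[k] w ∈ F := by
  intro k
  induction k with
  | zero => intro _; rw [Function.iterate_zero_apply]; exact hw
  | succ k ih =>
    intro hk
    have hmem := ih (Nat.le_of_succ_le hk)
    have hkY : p^[k] w ∉ Y := fun hY => by
      have h1 := (h0 _).2 hY
      have h2 := height_iterate_parent h0 hpar w k (Nat.le_of_succ_le hk)
      omega
    rw [Function.iterate_succ_apply']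
    exact hF _ hmem hkY

include h0 hpar in
/-- **A parent-closed set missing `c` misses the whole cone of `c`.** [cite: Diestel2010, Prop. 1.5.2] -/
theorem cone_inter_eq_empty_of_not_mem_of_parentClosed {F : Set V} (hF : ∀ w ∈ F, w ∉ Y → p w ∈ F) {c : V} (hc : c ∉ F) :
    {w | h c ≤ h w ∧ p^[h w - h c] w = c} ∩ F = ∅ := by
  rw [Set.eq_empty_iff_forall_notMem]
  rintro w ⟨⟨hcw, hw⟩, hwF⟩
  have := iterate_parent_mem_of_parentClosed h0 hpar hF hwF (h w - h c) (by omega)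
  rw [hw] at this
  exact hc this

/-! ## §2 The counting form: `#(Desc v ∩ S) = [v ∈ S] + Σ_{c child of v} #(Desc c ∩ S)` -/

include h0 hpar hchild in
/-- **(ii) THE COUNTING FORM OF THE DESCENDANT PARTITION — instance-free core.**  For any `S ⊆ V` with `Desc v ∩ S` finite and any Finset `s` of children of `v`
containing every child whose cone meets `S`:  `#(Desc v ∩ S) = [v ∈ S] + Σ_{c ∈ s} #(Desc c ∩ S)`.  (No local finiteness: the sum runs inside `s`.)
[cite: Serre1980Trees, I.2.3] [cite: Diestel2010, Prop. 1.5.2] -/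
theorem ncard_cone_inter_eq_add_sum_finset (v : V) (S : Set V) [DecidablePred (· ∈ S)]
    (hfin : ({w | h v ≤ h w ∧ p^[h w - h v] w = v} ∩ S).Finite) (s : Finset V) (hsub : ∀ c ∈ s, G.Adj v c ∧ h c = h v + 1)
    (hcov : ∀ c, G.Adj v c → h c = h v + 1 → ({w | h c ≤ h w ∧ p^[h w - h c] w = c} ∩ S).Nonempty → c ∈ s) :
    ({w | h v ≤ h w ∧ p^[h w - h v] w = v} ∩ S).ncard =
      (if v ∈ S then 1 else 0) + ∑ c ∈ s, ({w | h c ≤ h w ∧ p^[h w - h c] w = c} ∩ S).ncard := by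
  classical
  -- the cone of a child lies in the cone of `v`
  have hsub' : ∀ c ∈ s, {w | h c ≤ h w ∧ p^[h w - h c] w = c} ⊆ {w | h v ≤ h w ∧ p^[h w - h v] w = v} := fun c hc => by
    obtain ⟨hadj, hhc⟩ := hsub c hc
    have hcY : c ∉ Y := fun hmem => by have := (h0 c).2 hmem; omega
    exact cone_subset_cone_of_mem_cone (mem_cone_of_parent_eq hpar hcY (parent_eq_of_adj_of_height_succ h0 hchild hadj hhc))
  -- the partition, intersected with `S`
  have hsplit : {w | h v ≤ h w ∧ p^[h w - h v] w = v} ∩ S =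
      (({v} : Set V) ∩ S) ∪ ⋃ c ∈ s, ({w | h c ≤ h w ∧ p^[h w - h c] w = c} ∩ S) := by
    ext w
    simp only [Set.mem_union, Set.mem_inter_iff, Set.mem_singleton_iff, Set.mem_iUnion, exists_prop]
    constructor
    · rintro ⟨hw, hwS⟩
      have hw' := hw
      rw [cone_eq_insert_biUnion_cone_children h0 hpar hchild v, Set.mem_insert_iff, Set.mem_iUnion₂] at hw'
      rcases hw' with heq | ⟨c, ⟨hadj, hc⟩, hwc⟩
      · exact Or.inl ⟨heq, hwS⟩
      · exact Or.inr ⟨c, hcov c hadj hc ⟨w, hwc, hwS⟩, hwc, hwS⟩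
    · rintro (⟨rfl, hwS⟩ | ⟨c, hc, hwc, hwS⟩)
      · exact ⟨mem_cone_self w, hwS⟩
      · exact ⟨hsub' c hc hwc, hwS⟩
  have hdisj₁ : Disjoint (({v} : Set V) ∩ S) (⋃ c ∈ s, ({w | h c ≤ h w ∧ p^[h w - h c] w = c} ∩ S)) := by
    rw [Set.disjoint_left]
    rintro w ⟨hwv, -⟩ hw
    rw [Set.mem_singleton_iff] at hwv
    subst hwv
    simp only [Set.mem_iUnion, exists_prop] at hw
    obtain ⟨c, hc, hwc, -⟩ := hw
    exact not_mem_cone_child (hsub c hc).2 hwc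
  have hfin₁ : (({v} : Set V) ∩ S).Finite := (Set.finite_singleton v).subset Set.inter_subset_left
  have hfinc : ∀ c ∈ s, ({w | h c ≤ h w ∧ p^[h w - h c] w = c} ∩ S).Finite := fun c hc =>
    hfin.subset (Set.inter_subset_inter_left S (hsub' c hc))
  have hdisjs : ∀ c ∈ s, ∀ c' ∈ s, c ≠ c' →
      Disjoint ({w | h c ≤ h w ∧ p^[h w - h c] w = c} ∩ S) ({w | h c' ≤ h w ∧ p^[h w - h c'] w = c'} ∩ S) := fun c hc c' hc' hne =>
    (disjoint_cone_of_height_eq_of_ne ((hsub c hc).2.trans (hsub c' hc').2.symm) hne).mono Set.inter_subset_left Set.inter_subset_left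
  rw [hsplit, Set.ncard_union_eq hdisj₁ hfin₁ (Set.Finite.biUnion s.finite_toSet hfinc), ncard_biUnion_finset_eq_sum_of_disjoint s _ hfinc hdisjs]
  congr 1
  split_ifs with hvS
  · rw [Set.inter_eq_left.2 (Set.singleton_subset_iff.2 hvS), Set.ncard_singleton]
  · rw [Set.singleton_inter_eq_empty.2 hvS, Set.ncard_empty]

include h0 hpar hchild in
/-- **(ii, parent-closed Finset form) — BLUEPRINT (B3)(ii), instance-free.**  For a finite `F ⊆ V` closed under parents (`w ∈ F, w ∉ Y ⇒ p w ∈ F`), any predicate `P`,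
and any Finset `s` listing the children of `v` inside `F` (`c ∈ s ↔ v ~ c ∧ h c = h v + 1 ∧ c ∈ F`, the ★ `exists_finset_layer_succ` style):
`#(Desc v ∩ F ∩ P) = [v ∈ F ∧ P v] + Σ_{c ∈ s} #(Desc c ∩ F ∩ P)` (children outside `F` contribute nothing: `cone_inter_eq_empty_of_not_mem_of_parentClosed`).
[cite: Serre1980Trees, I.2.3] [cite: Diestel2010, Prop. 1.5.2] -/
theorem ncard_cone_inter_eq_add_sum_finset_of_parentClosed (v : V) (F : Set V) [DecidablePred (· ∈ F)] (hFfin : F.Finite)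
    (hF : ∀ w ∈ F, w ∉ Y → p w ∈ F) (P : V → Prop) [DecidablePred P] (s : Finset V) (hs : ∀ c, c ∈ s ↔ G.Adj v c ∧ h c = h v + 1 ∧ c ∈ F) :
    ({w | h v ≤ h w ∧ p^[h w - h v] w = v} ∩ F ∩ {w | P w}).ncard =
      (if v ∈ F ∧ P v then 1 else 0) + ∑ c ∈ s, ({w | h c ≤ h w ∧ p^[h w - h c] w = c} ∩ F ∩ {w | P w}).ncard := by
  classical
  have key := ncard_cone_inter_eq_add_sum_finset h0 hpar hchild v (F ∩ {w | P w})
    ((hFfin.subset Set.inter_subset_left).subset Set.inter_subset_right) s (fun c hc => ⟨((hs c).1 hc).1, ((hs c).1 hc).2.1⟩)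
    (fun c hadj hc hne => by
      refine (hs c).2 ⟨hadj, hc, ?_⟩
      by_contra hcF
      obtain ⟨w, hwc, hwF, -⟩ := hne
      have hempty := cone_inter_eq_empty_of_not_mem_of_parentClosed h0 hpar hF hcF
      exact (Set.eq_empty_iff_forall_notMem.1 hempty) w ⟨hwc, hwF⟩)
  simp only [← Set.inter_assoc] at key
  rw [key]
  congr 1

include h0 hpar hchild in
/-- **(ii, parent-closed `finsum` form), instance-free.**  `#(Desc v ∩ F ∩ P) = [v ∈ F ∧ P v] + ∑ᶠ_{c ∈ {children of v} ∩ F} #(Desc c ∩ F ∩ P)` for a finite parent-closed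
`F` and any `P`. [cite: Serre1980Trees, I.2.3] [cite: Diestel2010, Prop. 1.5.2] -/
theorem ncard_cone_inter_eq_add_finsum_of_parentClosed (v : V) (F : Set V) [DecidablePred (· ∈ F)] (hFfin : F.Finite)
    (hF : ∀ w ∈ F, w ∉ Y → p w ∈ F) (P : V → Prop) [DecidablePred P] :
    ({w | h v ≤ h w ∧ p^[h w - h v] w = v} ∩ F ∩ {w | P w}).ncard =
      (if v ∈ F ∧ P v then 1 else 0) +
        ∑ᶠ c ∈ {c | G.Adj v c ∧ h c = h v + 1} ∩ F, ({w | h c ≤ h w ∧ p^[h w - h c] w = c} ∩ F ∩ {w | P w}).ncard := by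
  have hsfin : ({c | G.Adj v c ∧ h c = h v + 1} ∩ F).Finite := hFfin.subset Set.inter_subset_right
  rw [finsum_mem_eq_finite_toFinset_sum _ hsfin]
  exact ncard_cone_inter_eq_add_sum_finset_of_parentClosed h0 hpar hchild v F hFfin hF P hsfin.toFinset
    (fun c => by rw [Set.Finite.mem_toFinset, Set.mem_inter_iff, Set.mem_setOf_eq, and_assoc])

variable [G.LocallyFinite]

include h0 hpar hchild in
/-- **(ii) THE COUNTING FORM, locally finite spelling.**  For any `S ⊆ V` with `Desc v ∩ S` finite:
`#(Desc v ∩ S) = [v ∈ S] + Σ_{c child of v} #(Desc c ∩ S)`, the sum running over the Finset of ALL children `(G.neighborFinset v).filter (h · = h v + 1)`.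
[cite: Serre1980Trees, I.2.3] [cite: Diestel2010, Prop. 1.5.2] -/
theorem ncard_cone_inter_eq_add_sum (v : V) (S : Set V) [DecidablePred (· ∈ S)]
    (hfin : ({w | h v ≤ h w ∧ p^[h w - h v] w = v} ∩ S).Finite) :
    ({w | h v ≤ h w ∧ p^[h w - h v] w = v} ∩ S).ncard =
      (if v ∈ S then 1 else 0) +
        ∑ c ∈ (G.neighborFinset v).filter (fun c => h c = h v + 1), ({w | h c ≤ h w ∧ p^[h w - h c] w = c} ∩ S).ncard :=
  ncard_cone_inter_eq_add_sum_finset h0 hpar hchild v S hfin _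
    (fun c hc => by rw [Finset.mem_filter, mem_neighborFinset] at hc; exact hc)
    (fun c hadj hc _ => by rw [Finset.mem_filter, mem_neighborFinset]; exact ⟨hadj, hc⟩)

include h0 hpar hchild in
/-- **(ii, parent-closed form), locally finite spelling — BLUEPRINT (B3)(ii).**  For a finite `F ⊆ V` closed under parents and any predicate `P`:
`#(Desc v ∩ F ∩ P) = [v ∈ F ∧ P v] + Σ_{c child of v, c ∈ F} #(Desc c ∩ F ∩ P)`, summed over `(G.neighborFinset v).filter (h · = h v + 1 ∧ · ∈ F)`.
[cite: Serre1980Trees, I.2.3] [cite: Diestel2010, Prop. 1.5.2] -/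
theorem ncard_cone_inter_eq_add_sum_of_parentClosed (v : V) (F : Set V) [DecidablePred (· ∈ F)] (hFfin : F.Finite)
    (hF : ∀ w ∈ F, w ∉ Y → p w ∈ F) (P : V → Prop) [DecidablePred P] :
    ({w | h v ≤ h w ∧ p^[h w - h v] w = v} ∩ F ∩ {w | P w}).ncard =
      (if v ∈ F ∧ P v then 1 else 0) +
        ∑ c ∈ (G.neighborFinset v).filter (fun c => h c = h v + 1 ∧ c ∈ F), ({w | h c ≤ h w ∧ p^[h w - h c] w = c} ∩ F ∩ {w | P w}).ncard :=
  ncard_cone_inter_eq_add_sum_finset_of_parentClosed h0 hpar hchild v F hFfin hF P _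
    (fun c => by rw [Finset.mem_filter, mem_neighborFinset])

end Cone

/-! ## §3 The cone is the geodesic shadow: `w ∈ Desc v ↔ h w = h v + dist(v, w)` -/

section Shadow

variable {Y : Set V} {h : V → ℕ} {p : V → V}
  (h0 : ∀ v, h v = 0 ↔ v ∈ Y) (hpar : ∀ v, v ∉ Y → G.Adj v (p v) ∧ h (p v) + 1 = h v)
  (hchild : ∀ v w, v ∉ Y → G.Adj v w → w ≠ p v → h w = h v + 1 ∧ p w = v)

/-- **The height is 1-Lipschitz**: `h w ≤ h v + dist(v, w)` (`G` connected, (dist) clause). [cite: Serre1980Trees, I.2.3] -/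
theorem height_le_height_add_dist (hc : G.Connected) (hdist : ∀ v, (∃ y ∈ Y, G.dist v y = h v) ∧ ∀ y ∈ Y, h v ≤ G.dist v y) (v w : V) :
    h w ≤ h v + G.dist v w := by
  obtain ⟨y, hy, hvy⟩ := (hdist v).1
  have hwy : h w ≤ G.dist w y := (hdist w).2 y hy
  have htri : G.dist w y ≤ G.dist w v + G.dist v y := hc.dist_triangle
  have hsym : G.dist w v = G.dist v w := SimpleGraph.dist_comm
  omega

include h0 hpar in
/-- A descendant `w` of `v` is joined to `v` by the descent of length `h w − h v`: `dist(w, v) ≤ h w − h v`. [cite: Serre1980Trees, I.2.3] -/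
theorem dist_le_height_sub_of_mem_cone {v w : V} (hw : w ∈ {w | h v ≤ h w ∧ p^[h w - h v] w = v}) : G.dist w v ≤ h w - h v := by
  obtain ⟨hvw, hwv⟩ := hw
  obtain ⟨W, hW⟩ := exists_walk_iterate_parent h0 hpar (h w - h v) w (by omega)
  have hle := dist_le (W.copy rfl hwv)
  rw [Walk.length_copy, hW] at hle
  exact hle

include h0 hpar in
/-- **Descendants are in the geodesic shadow**: `w ∈ Desc v ⇒ h w = h v + dist(v, w)`. [cite: Serre1980Trees, I.2.3] -/
theorem height_eq_add_dist_of_mem_cone (hc : G.Connected) (hdist : ∀ v, (∃ y ∈ Y, G.dist v y = h v) ∧ ∀ y ∈ Y, h v ≤ G.dist v y)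
    {v w : V} (hw : w ∈ {w | h v ≤ h w ∧ p^[h w - h v] w = v}) : h w = h v + G.dist v w := by
  have h1 := height_le_height_add_dist hc hdist v w
  have h2 := dist_le_height_sub_of_mem_cone h0 hpar hw
  have hsym : G.dist w v = G.dist v w := SimpleGraph.dist_comm
  have h3 := hw.1
  omega

include h0 hpar hchild in
/-- **The geodesic shadow consists of descendants**: if `h w = h v + dist(v, w)` then `w ∈ Desc v` (induction on `dist(v, w)`: the first edge of a geodesic from `w` to `v`
goes DOWN — a child `u` of `w` would have `h u = h w + 1 > h v + dist(v, u)`, against the Lipschitz bound). [cite: Serre1980Trees, I.2.3] [cite: Diestel2010, Thm. 1.5.1] -/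
theorem mem_cone_of_height_eq_add_dist (hc : G.Connected) (hdist : ∀ v, (∃ y ∈ Y, G.dist v y = h v) ∧ ∀ y ∈ Y, h v ≤ G.dist v y) :
    ∀ (n : ℕ) {v w : V}, G.dist v w = n → h w = h v + G.dist v w → w ∈ {w | h v ≤ h w ∧ p^[h w - h v] w = v} := by
  intro n
  induction n with
  | zero =>
    intro v w hd _
    have hvw : v = w := hc.dist_eq_zero_iff.1 hd
    subst hvw
    exact mem_cone_self v
  | succ n ih =>
    intro v w hd hh
    have hne : w ≠ v := by
      rintro rfl
      rw [SimpleGraph.dist_self] at hd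
      exact absurd hd (by omega)
    -- a geodesic from `w` to `v` and its first edge `w ~ u`
    obtain ⟨W, hW⟩ := hc.exists_walk_length_eq_dist w v
    cases W with
    | nil => exact absurd rfl hne
    | @cons _ u _ hadj W' =>
      rw [Walk.length_cons, SimpleGraph.dist_comm, hd] at hW
      have huv : G.dist v u ≤ n := by
        rw [SimpleGraph.dist_comm]
        have := dist_le W'
        omega
      have hwY : w ∉ Y := fun hmem => by have := (h0 w).2 hmem; omega
      -- `u` is the parent of `w`
      have hup : u = p w := by
        by_contra hup
        have hhu := (hchild w u hwY hadj hup).1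
        have hlip := height_le_height_add_dist hc hdist v u
        omega
      subst hup
      have hhp := (hpar w hwY).2
      have hdp : G.dist v (p w) = n := by
        have hlip := height_le_height_add_dist hc hdist v (p w)
        omega
      have key := ih hdp (by omega)
      exact (mem_cone_iff_parent_mem_cone h0 hpar hne).2 ⟨by omega, key⟩

include h0 hpar hchild in
/-- **THE CONE IS THE GEODESIC SHADOW**: `w ∈ Desc v ↔ h w = h v + dist(v, w)` (`G` connected, (dist) clause). [cite: Serre1980Trees, I.2.3] [cite: Diestel2010, Thm. 1.5.1] -/
theorem mem_cone_iff_height_eq_add_dist (hc : G.Connected) (hdist : ∀ v, (∃ y ∈ Y, G.dist v y = h v) ∧ ∀ y ∈ Y, h v ≤ G.dist v y) (v w : V) :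
    w ∈ {w | h v ≤ h w ∧ p^[h w - h v] w = v} ↔ h w = h v + G.dist v w :=
  ⟨height_eq_add_dist_of_mem_cone h0 hpar hc hdist, mem_cone_of_height_eq_add_dist h0 hpar hchild hc hdist _ rfl⟩

end Shadow

/-! ## §4 Rooted intrinsic forms: `Desc(v) = {w | dist(r,w) = dist(r,v) + dist(v,w)}` in a tree with root `r` -/

section Rooted

/-- **A rooted tree has a parent map**: for a tree `G` and a root `r` there is `p : V → V` with (P2) `v ≠ r ⇒ v ~ p v ∧ dist(r, p v) + 1 = dist(r, v)`, (P5) the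
other neighbours `w` of `v ≠ r` are children (`dist(r, w) = dist(r, v) + 1 ∧ p w = v`), the neighbours of `r` are children of `r`, and the DESCENDANTS of `v` — the
geodesic shadow `{w | dist(r,w) = dist(r,v) + dist(v,w)}` — are the `w` with `p^[dist(r,w) − dist(r,v)] w = v`. [cite: Serre1980Trees, I.2.3] [cite: Diestel2010, Thm. 1.5.1] -/
theorem exists_rooted_parent (hT : G.IsTree) (r : V) :
    ∃ p : V → V, (∀ v, v ≠ r → G.Adj v (p v) ∧ G.dist r (p v) + 1 = G.dist r v) ∧
      (∀ v w, v ≠ r → G.Adj v w → w ≠ p v → G.dist r w = G.dist r v + 1 ∧ p w = v) ∧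
      (∀ w, G.Adj r w → p w = r) ∧
      ∀ v w, G.dist r w = G.dist r v + G.dist v w ↔ G.dist r v ≤ G.dist r w ∧ p^[G.dist r w - G.dist r v] w = v := by
  obtain ⟨h, p, hdist, h0, hpar, -, hchild, -⟩ :=
    TreeRetraction.exists_retraction hT (Y := ({r} : Set V)) ⟨r, rfl⟩ (connected_induce_singleton r)
  have hh : ∀ v, h v = G.dist r v := height_eq_dist_of_singleton hdist
  refine ⟨p, fun v hv => ?_, fun v w hv => ?_, fun w hw => ?_, fun v w => ?_⟩
  · have key := hpar v (fun hmem => hv (Set.mem_singleton_iff.1 hmem))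
    simp only [hh] at key
    exact key
  · have key := hchild v w (fun hmem => hv (Set.mem_singleton_iff.1 hmem))
    simp only [hh] at key
    exact key
  · have key := parent_eq_of_adj_of_height_succ h0 hchild hw (by rw [hh, hh, SimpleGraph.dist_self, dist_eq_one_iff_adj.2 hw])
    exact key
  · have key := mem_cone_iff_height_eq_add_dist h0 hpar hchild hT.1 hdist v w
    simp only [Set.mem_setOf_eq, hh] at key
    exact key.symm

/-- **(i) THE DESCENDANT PARTITION, rooted form.**  In a tree with root `r`:
`{w | dist(r,w) = dist(r,v) + dist(v,w)} = {v} ∪ ⋃_{c ~ v, dist(r,c) = dist(r,v)+1} {w | dist(r,w) = dist(r,c) + dist(c,w)}`. [cite: Serre1980Trees, I.2.3] [cite: Diestel2010, Thm. 1.5.1] -/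
theorem setOf_dist_eq_add_dist_eq_insert_biUnion (hT : G.IsTree) (r v : V) :
    {w | G.dist r w = G.dist r v + G.dist v w} =
      insert v (⋃ c ∈ {c | G.Adj v c ∧ G.dist r c = G.dist r v + 1}, {w | G.dist r w = G.dist r c + G.dist c w}) := by
  obtain ⟨h, p, hdist, h0, hpar, -, hchild, -⟩ :=
    TreeRetraction.exists_retraction hT (Y := ({r} : Set V)) ⟨r, rfl⟩ (connected_induce_singleton r)
  have hh : ∀ v, h v = G.dist r v := height_eq_dist_of_singleton hdist
  have hmem : ∀ u w, G.dist r w = G.dist r u + G.dist u w ↔ w ∈ {w | h u ≤ h w ∧ p^[h w - h u] w = u} := fun u w => by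
    rw [mem_cone_iff_height_eq_add_dist h0 hpar hchild hT.1 hdist u w, hh, hh]
  ext w
  rw [Set.mem_setOf_eq, hmem, cone_eq_insert_biUnion_cone_children h0 hpar hchild v, Set.mem_insert_iff, Set.mem_insert_iff,
    Set.mem_iUnion₂, Set.mem_iUnion₂]
  constructor
  · rintro (heq | ⟨c, ⟨hadj, hc⟩, hw⟩)
    · exact Or.inl heq
    · refine Or.inr ⟨c, ⟨hadj, by rw [← hh, ← hh, hc]⟩, ?_⟩
      show G.dist r w = G.dist r c + G.dist c w
      exact (hmem c w).2 hw
  · rintro (heq | ⟨c, ⟨hadj, hc⟩, hw⟩)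
    · exact Or.inl heq
    · refine Or.inr ⟨c, ⟨hadj, by rw [hh, hh, hc]⟩, ?_⟩
      exact (hmem c w).1 hw

/-- `v` is not a descendant of any of its children. [cite: Serre1980Trees, I.2.3] -/
theorem not_mem_setOf_dist_child (r : V) {v c : V} (hc : G.dist r c = G.dist r v + 1) :
    v ∉ {w | G.dist r w = G.dist r c + G.dist c w} := by
  intro hv
  rw [Set.mem_setOf_eq] at hv
  omega

/-- **Distinct vertices of the same level have disjoint descendant sets** (in particular two distinct children of `v`). [cite: Serre1980Trees, I.2.3] [cite: Diestel2010, Thm. 1.5.1] -/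
theorem disjoint_setOf_dist_of_ne (hT : G.IsTree) (r : V) {c c' : V} (hcc : G.dist r c = G.dist r c') (hne : c ≠ c') :
    Disjoint {w | G.dist r w = G.dist r c + G.dist c w} {w | G.dist r w = G.dist r c' + G.dist c' w} := by
  obtain ⟨h, p, hdist, h0, hpar, -, hchild, -⟩ :=
    TreeRetraction.exists_retraction hT (Y := ({r} : Set V)) ⟨r, rfl⟩ (connected_induce_singleton r)
  have hh : ∀ v, h v = G.dist r v := height_eq_dist_of_singleton hdist
  have hcone : ∀ u, {w | G.dist r w = G.dist r u + G.dist u w} = {w | h u ≤ h w ∧ p^[h w - h u] w = u} := fun u => by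
    ext w
    rw [Set.mem_setOf_eq, mem_cone_iff_height_eq_add_dist h0 hpar hchild hT.1 hdist u w, hh, hh]
  rw [hcone c, hcone c']
  exact disjoint_cone_of_height_eq_of_ne (by rw [hh, hh, hcc]) hne

/-- **Transitivity, rooted form**: the descendants of a child `c` of `v` (indeed of any descendant of `v`) are descendants of `v`. [cite: Serre1980Trees, I.2.3] -/
theorem setOf_dist_subset_of_mem (hT : G.IsTree) (r : V) {v c : V} (hc : G.dist r c = G.dist r v + G.dist v c) :
    {w | G.dist r w = G.dist r c + G.dist c w} ⊆ {w | G.dist r w = G.dist r v + G.dist v w} := by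
  obtain ⟨h, p, hdist, h0, hpar, -, hchild, -⟩ :=
    TreeRetraction.exists_retraction hT (Y := ({r} : Set V)) ⟨r, rfl⟩ (connected_induce_singleton r)
  have hh : ∀ v, h v = G.dist r v := height_eq_dist_of_singleton hdist
  have hcone : ∀ u, {w | G.dist r w = G.dist r u + G.dist u w} = {w | h u ≤ h w ∧ p^[h w - h u] w = u} := fun u => by
    ext w
    rw [Set.mem_setOf_eq, mem_cone_iff_height_eq_add_dist h0 hpar hchild hT.1 hdist u w, hh, hh]
  rw [hcone c, hcone v]
  refine cone_subset_cone_of_mem_cone ?_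
  show c ∈ {w | h v ≤ h w ∧ p^[h w - h v] w = v}
  rw [← hcone v]
  exact hc

/-- **(ii, parent-closed Finset form), rooted, instance-free — BLUEPRINT (B3)(ii).**  For a finite `F ⊆ V` closed under parents («`w ∈ F`, `w ≠ r` ⇒ the neighbour of
`w` one step closer to `r` lies in `F`»), any predicate `P` and any Finset `s` listing the children of `v` inside `F` (`c ∈ s ↔ v ~ c ∧ dist(r,c) = dist(r,v)+1 ∧ c ∈ F`):
`#(Desc v ∩ F ∩ P) = [v ∈ F ∧ P v] + Σ_{c ∈ s} #(Desc c ∩ F ∩ P)`.  No local finiteness. [cite: Serre1980Trees, I.2.3] [cite: Diestel2010, Prop. 1.5.2] -/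
theorem ncard_setOf_dist_inter_eq_add_sum_finset_of_parentClosed (hT : G.IsTree) (r v : V) (F : Set V) [DecidablePred (· ∈ F)] (hFfin : F.Finite)
    (hF : ∀ w ∈ F, w ≠ r → ∀ u, G.Adj w u → G.dist r u + 1 = G.dist r w → u ∈ F) (P : V → Prop) [DecidablePred P]
    (s : Finset V) (hs : ∀ c, c ∈ s ↔ G.Adj v c ∧ G.dist r c = G.dist r v + 1 ∧ c ∈ F) :
    ({w | G.dist r w = G.dist r v + G.dist v w} ∩ F ∩ {w | P w}).ncard =
      (if v ∈ F ∧ P v then 1 else 0) + ∑ c ∈ s, ({w | G.dist r w = G.dist r c + G.dist c w} ∩ F ∩ {w | P w}).ncard := by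
  obtain ⟨h, p, hdist, h0, hpar, -, hchild, -⟩ :=
    TreeRetraction.exists_retraction hT (Y := ({r} : Set V)) ⟨r, rfl⟩ (connected_induce_singleton r)
  have hh : ∀ v, h v = G.dist r v := height_eq_dist_of_singleton hdist
  have hcone : ∀ u, {w | G.dist r w = G.dist r u + G.dist u w} = {w | h u ≤ h w ∧ p^[h w - h u] w = u} := fun u => by
    ext w
    rw [Set.mem_setOf_eq, mem_cone_iff_height_eq_add_dist h0 hpar hchild hT.1 hdist u w, hh, hh]
  have hF' : ∀ w ∈ F, w ∉ ({r} : Set V) → p w ∈ F := fun w hw hwr => by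
    obtain ⟨hadj, hhp⟩ := hpar w hwr
    exact hF w hw (fun heq => hwr (Set.mem_singleton_iff.2 heq)) (p w) hadj (by rw [← hh, ← hh, hhp])
  have key := ncard_cone_inter_eq_add_sum_finset_of_parentClosed h0 hpar hchild v F hFfin hF' P s (fun c => by rw [hs c, hh, hh])
  rw [hcone v, key]
  congr 1
  exact Finset.sum_congr rfl (fun c _ => by rw [hcone c])

/-- **(ii, parent-closed `finsum` form), rooted, instance-free.**  `#(Desc v ∩ F ∩ P) = [v ∈ F ∧ P v] + ∑ᶠ_{c ∈ {c ~ v | dist(r,c) = dist(r,v)+1} ∩ F} #(Desc c ∩ F ∩ P)`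
for a finite parent-closed `F` and any `P` (only `F.Finite` and parent-closedness are assumed). [cite: Serre1980Trees, I.2.3] [cite: Diestel2010, Prop. 1.5.2] -/
theorem ncard_setOf_dist_inter_eq_add_finsum_of_parentClosed (hT : G.IsTree) (r v : V) (F : Set V) [DecidablePred (· ∈ F)] (hFfin : F.Finite)
    (hF : ∀ w ∈ F, w ≠ r → ∀ u, G.Adj w u → G.dist r u + 1 = G.dist r w → u ∈ F) (P : V → Prop) [DecidablePred P] :
    ({w | G.dist r w = G.dist r v + G.dist v w} ∩ F ∩ {w | P w}).ncard =
      (if v ∈ F ∧ P v then 1 else 0) +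
        ∑ᶠ c ∈ {c | G.Adj v c ∧ G.dist r c = G.dist r v + 1} ∩ F, ({w | G.dist r w = G.dist r c + G.dist c w} ∩ F ∩ {w | P w}).ncard := by
  have hsfin : ({c | G.Adj v c ∧ G.dist r c = G.dist r v + 1} ∩ F).Finite := hFfin.subset Set.inter_subset_right
  rw [finsum_mem_eq_finite_toFinset_sum _ hsfin]
  exact ncard_setOf_dist_inter_eq_add_sum_finset_of_parentClosed hT r v F hFfin hF P hsfin.toFinset
    (fun c => by rw [Set.Finite.mem_toFinset, Set.mem_inter_iff, Set.mem_setOf_eq, and_assoc])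

/-- **Two steps under a predicate vanishing on the children (`finsum` form, instance-free).**  If `P` fails on every child of `v` (the bipartite use: `P` = «self-dual ∧ label»
vanishes on the modular layer) then `#(Desc v ∩ F ∩ P) = [v ∈ F ∧ P v] + ∑ᶠ_{c child of v, c ∈ F} ∑ᶠ_{d child of c, d ∈ F} #(Desc d ∩ F ∩ P)` — the GRANDCHILDREN recursion.
[cite: Serre1980Trees, I.2.3] [cite: Serre1980Trees, II.1.1] -/
theorem ncard_setOf_dist_inter_eq_add_finsum_finsum_of_parentClosed (hT : G.IsTree) (r v : V) (F : Set V) [DecidablePred (· ∈ F)] (hFfin : F.Finite)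
    (hF : ∀ w ∈ F, w ≠ r → ∀ u, G.Adj w u → G.dist r u + 1 = G.dist r w → u ∈ F) (P : V → Prop) [DecidablePred P]
    (hP : ∀ c, G.Adj v c → G.dist r c = G.dist r v + 1 → ¬ P c) :
    ({w | G.dist r w = G.dist r v + G.dist v w} ∩ F ∩ {w | P w}).ncard =
      (if v ∈ F ∧ P v then 1 else 0) +
        ∑ᶠ c ∈ {c | G.Adj v c ∧ G.dist r c = G.dist r v + 1} ∩ F,
          ∑ᶠ d ∈ {d | G.Adj c d ∧ G.dist r d = G.dist r c + 1} ∩ F, ({w | G.dist r w = G.dist r d + G.dist d w} ∩ F ∩ {w | P w}).ncard := by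
  rw [ncard_setOf_dist_inter_eq_add_finsum_of_parentClosed hT r v F hFfin hF P]
  congr 1
  refine finsum_mem_congr rfl (fun c hc => ?_)
  have hc' : G.Adj v c ∧ G.dist r c = G.dist r v + 1 := hc.1
  rw [ncard_setOf_dist_inter_eq_add_finsum_of_parentClosed hT r c F hFfin hF P, if_neg (fun hcP => hP c hc'.1 hc'.2 hcP.2), zero_add]

/-- **Two steps under a predicate vanishing on the children (Finset form, instance-free)**: with `s` listing the children of `v` in `F` and `t c` the children of `c` in `F`,
`#(Desc v ∩ F ∩ P) = [v ∈ F ∧ P v] + Σ_{c ∈ s} Σ_{d ∈ t c} #(Desc d ∩ F ∩ P)`. [cite: Serre1980Trees, I.2.3] [cite: Serre1980Trees, II.1.1] -/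
theorem ncard_setOf_dist_inter_eq_add_sum_sum_finset_of_parentClosed (hT : G.IsTree) (r v : V) (F : Set V) [DecidablePred (· ∈ F)] (hFfin : F.Finite)
    (hF : ∀ w ∈ F, w ≠ r → ∀ u, G.Adj w u → G.dist r u + 1 = G.dist r w → u ∈ F) (P : V → Prop) [DecidablePred P]
    (hP : ∀ c, G.Adj v c → G.dist r c = G.dist r v + 1 → ¬ P c)
    (s : Finset V) (hs : ∀ c, c ∈ s ↔ G.Adj v c ∧ G.dist r c = G.dist r v + 1 ∧ c ∈ F)
    (t : V → Finset V) (ht : ∀ c ∈ s, ∀ d, d ∈ t c ↔ G.Adj c d ∧ G.dist r d = G.dist r c + 1 ∧ d ∈ F) :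
    ({w | G.dist r w = G.dist r v + G.dist v w} ∩ F ∩ {w | P w}).ncard =
      (if v ∈ F ∧ P v then 1 else 0) + ∑ c ∈ s, ∑ d ∈ t c, ({w | G.dist r w = G.dist r d + G.dist d w} ∩ F ∩ {w | P w}).ncard := by
  rw [ncard_setOf_dist_inter_eq_add_sum_finset_of_parentClosed hT r v F hFfin hF P s hs]
  congr 1
  refine Finset.sum_congr rfl (fun c hc => ?_)
  obtain ⟨hadj, hdc, -⟩ := (hs c).1 hc
  rw [ncard_setOf_dist_inter_eq_add_sum_finset_of_parentClosed hT r c F hFfin hF P (t c) (ht c hc), if_neg (fun hcP => hP c hadj hdc hcP.2), zero_add]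

/-- **The fixed set of a root-fixing automorphism is parent-closed** (the shape of `hF` above for `F = {v | φ v = v}`): if `φ r = r`, `φ w = w`, `w ≠ r`, and `u ~ w` is the
neighbour one step closer to `r`, then `φ u = u` (★ `exists_retraction` (P4): the parent map commutes with `Y`-preserving automorphisms).  [cite: Serre1980Trees, I.6.4 Prop. 24]
[cite: Diestel2010, Thm. 1.5.1] -/
theorem parentClosed_fixedPoints (hT : G.IsTree) (r : V) (φ : G ≃g G) (hφ : φ r = r) :
    ∀ w ∈ {v | φ v = v}, w ≠ r → ∀ u, G.Adj w u → G.dist r u + 1 = G.dist r w → u ∈ {v | φ v = v} := by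
  obtain ⟨h, p, hdist, -, -, -, hchild, hequi⟩ :=
    TreeRetraction.exists_retraction hT (Y := ({r} : Set V)) ⟨r, rfl⟩ (connected_induce_singleton r)
  have hh : ∀ v, h v = G.dist r v := height_eq_dist_of_singleton hdist
  have hY : ∀ v, φ v ∈ ({r} : Set V) ↔ v ∈ ({r} : Set V) := fun v => by
    simp only [Set.mem_singleton_iff]
    exact ⟨fun hv => φ.injective (hv.trans hφ.symm), fun hv => by rw [hv, hφ]⟩
  intro w hw hwr u hadj hdu
  have hwY : w ∉ ({r} : Set V) := fun hmem => hwr (Set.mem_singleton_iff.1 hmem)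
  have hpw : p w = u := parent_eq_of_adj_of_height hchild hwY hadj (by rw [hh, hh]; omega)
  have key := ((hequi φ hY) w).2 hwY
  rw [Set.mem_setOf_eq] at hw ⊢
  rw [hw, hpw] at key
  exact key.symm

variable [G.LocallyFinite]

/-- **(ii) THE COUNTING FORM, rooted.**  In a locally finite tree with root `r`, for any `S ⊆ V` meeting the descendants of `v` in a finite set:
`#(Desc v ∩ S) = [v ∈ S] + Σ_{c ~ v, dist(r,c) = dist(r,v)+1} #(Desc c ∩ S)`. [cite: Serre1980Trees, I.2.3] [cite: Diestel2010, Prop. 1.5.2] -/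
theorem ncard_setOf_dist_inter_eq_add_sum (hT : G.IsTree) (r v : V) (S : Set V) [DecidablePred (· ∈ S)]
    (hfin : ({w | G.dist r w = G.dist r v + G.dist v w} ∩ S).Finite) :
    ({w | G.dist r w = G.dist r v + G.dist v w} ∩ S).ncard =
      (if v ∈ S then 1 else 0) +
        ∑ c ∈ (G.neighborFinset v).filter (fun c => G.dist r c = G.dist r v + 1), ({w | G.dist r w = G.dist r c + G.dist c w} ∩ S).ncard := by
  obtain ⟨h, p, hdist, h0, hpar, -, hchild, -⟩ :=
    TreeRetraction.exists_retraction hT (Y := ({r} : Set V)) ⟨r, rfl⟩ (connected_induce_singleton r)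
  have hh : ∀ v, h v = G.dist r v := height_eq_dist_of_singleton hdist
  have hcone : ∀ u, {w | G.dist r w = G.dist r u + G.dist u w} = {w | h u ≤ h w ∧ p^[h w - h u] w = u} := fun u => by
    ext w
    rw [Set.mem_setOf_eq, mem_cone_iff_height_eq_add_dist h0 hpar hchild hT.1 hdist u w, hh, hh]
  have key := ncard_cone_inter_eq_add_sum h0 hpar hchild v S (by rw [← hcone v]; exact hfin)
  rw [hcone v, key]
  congr 1
  refine Finset.sum_congr ?_ (fun c _ => by rw [hcone c])
  ext c
  simp only [Finset.mem_filter, hh]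

/-- **(ii, parent-closed form) — BLUEPRINT (B3)(ii), rooted.**  For a finite `F ⊆ V` closed under parents («`w ∈ F`, `w ≠ r` ⇒ the neighbour of `w` one step closer to
`r` lies in `F`») and any predicate `P`: `#(Desc v ∩ F ∩ P) = [v ∈ F ∧ P v] + Σ_{c child of v, c ∈ F} #(Desc c ∩ F ∩ P)`. [cite: Serre1980Trees, I.2.3] [cite: Diestel2010, Prop. 1.5.2] -/
theorem ncard_setOf_dist_inter_eq_add_sum_of_parentClosed (hT : G.IsTree) (r v : V) (F : Set V) [DecidablePred (· ∈ F)] (hFfin : F.Finite)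
    (hF : ∀ w ∈ F, w ≠ r → ∀ u, G.Adj w u → G.dist r u + 1 = G.dist r w → u ∈ F) (P : V → Prop) [DecidablePred P] :
    ({w | G.dist r w = G.dist r v + G.dist v w} ∩ F ∩ {w | P w}).ncard =
      (if v ∈ F ∧ P v then 1 else 0) +
        ∑ c ∈ (G.neighborFinset v).filter (fun c => G.dist r c = G.dist r v + 1 ∧ c ∈ F),
          ({w | G.dist r w = G.dist r c + G.dist c w} ∩ F ∩ {w | P w}).ncard := by
  obtain ⟨h, p, hdist, h0, hpar, -, hchild, -⟩ :=
    TreeRetraction.exists_retraction hT (Y := ({r} : Set V)) ⟨r, rfl⟩ (connected_induce_singleton r)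
  have hh : ∀ v, h v = G.dist r v := height_eq_dist_of_singleton hdist
  have hcone : ∀ u, {w | G.dist r w = G.dist r u + G.dist u w} = {w | h u ≤ h w ∧ p^[h w - h u] w = u} := fun u => by
    ext w
    rw [Set.mem_setOf_eq, mem_cone_iff_height_eq_add_dist h0 hpar hchild hT.1 hdist u w, hh, hh]
  have hF' : ∀ w ∈ F, w ∉ ({r} : Set V) → p w ∈ F := fun w hw hwr => by
    obtain ⟨hadj, hhp⟩ := hpar w hwr
    exact hF w hw (fun heq => hwr (Set.mem_singleton_iff.2 heq)) (p w) hadj (by rw [← hh, ← hh, hhp])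
  have key := ncard_cone_inter_eq_add_sum_of_parentClosed h0 hpar hchild v F hFfin hF' P
  rw [hcone v, key]
  congr 1
  refine Finset.sum_congr ?_ (fun c _ => by rw [hcone c])
  ext c
  simp only [Finset.mem_filter, hh]

/-- **Two steps: children and GRANDCHILDREN.**  `#(Desc v ∩ S) = [v ∈ S] + Σ_{c child of v} ([c ∈ S] + Σ_{d child of c} #(Desc d ∩ S))` — the form used on the bipartite
(self-dual ∕ modular) lattice tree, where the odd layer carries no stratum. [cite: Serre1980Trees, I.2.3] [cite: Serre1980Trees, II.1.1] -/
theorem ncard_setOf_dist_inter_eq_add_sum_sum (hT : G.IsTree) (r v : V) (S : Set V) [DecidablePred (· ∈ S)]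
    (hfin : ({w | G.dist r w = G.dist r v + G.dist v w} ∩ S).Finite) :
    ({w | G.dist r w = G.dist r v + G.dist v w} ∩ S).ncard =
      (if v ∈ S then 1 else 0) +
        ∑ c ∈ (G.neighborFinset v).filter (fun c => G.dist r c = G.dist r v + 1),
          ((if c ∈ S then 1 else 0) +
            ∑ d ∈ (G.neighborFinset c).filter (fun d => G.dist r d = G.dist r c + 1), ({w | G.dist r w = G.dist r d + G.dist d w} ∩ S).ncard) := by
  rw [ncard_setOf_dist_inter_eq_add_sum hT r v S hfin]
  congr 1
  refine Finset.sum_congr rfl (fun c hc => ?_)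
  rw [Finset.mem_filter, mem_neighborFinset] at hc
  have hsub : {w | G.dist r w = G.dist r c + G.dist c w} ⊆ {w | G.dist r w = G.dist r v + G.dist v w} :=
    setOf_dist_subset_of_mem hT r (by rw [hc.2, dist_eq_one_iff_adj.2 hc.1])
  exact ncard_setOf_dist_inter_eq_add_sum hT r c S (hfin.subset (Set.inter_subset_inter_left S hsub))

end Rooted

/-! ## §5 Conveniences for the induction: the root, the leaves, and the `Finset.filter` spelling -/

section RootedExtras

/-- **Every vertex descends from the root**: `Desc(r) = V`. [cite: Serre1980Trees, I.2.3] -/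
theorem setOf_dist_eq_add_dist_root (r : V) : {w | G.dist r w = G.dist r r + G.dist r w} = Set.univ := by
  ext w
  simp only [Set.mem_setOf_eq, Set.mem_univ, SimpleGraph.dist_self, zero_add]

/-- The children of the root are all its neighbours: `r ~ c ⇒ dist(r, c) = dist(r, r) + 1`. [cite: Serre1980Trees, I.2.3] -/
theorem dist_eq_dist_self_add_one_of_adj {r c : V} (hadj : G.Adj r c) : G.dist r c = G.dist r r + 1 := by
  rw [SimpleGraph.dist_self, zero_add, dist_eq_one_iff_adj.2 hadj]

/-- **The count at the ROOT** (instance-free): for a finite parent-closed `F` and any `P`,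
`#(F ∩ P) = [r ∈ F ∧ P r] + ∑ᶠ_{c ~ r, c ∈ F} #(Desc c ∩ F ∩ P)`. [cite: Serre1980Trees, I.2.3] [cite: Diestel2010, Prop. 1.5.2] -/
theorem ncard_inter_eq_add_finsum_root_of_parentClosed (hT : G.IsTree) (r : V) (F : Set V) [DecidablePred (· ∈ F)] (hFfin : F.Finite)
    (hF : ∀ w ∈ F, w ≠ r → ∀ u, G.Adj w u → G.dist r u + 1 = G.dist r w → u ∈ F) (P : V → Prop) [DecidablePred P] :
    (F ∩ {w | P w}).ncard =
      (if r ∈ F ∧ P r then 1 else 0) + ∑ᶠ c ∈ {c | G.Adj r c} ∩ F, ({w | G.dist r w = G.dist r c + G.dist c w} ∩ F ∩ {w | P w}).ncard := by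
  have key := ncard_setOf_dist_inter_eq_add_finsum_of_parentClosed hT r r F hFfin hF P
  rw [setOf_dist_eq_add_dist_root, Set.univ_inter] at key
  rw [key]
  congr 1
  refine finsum_mem_congr ?_ (fun _ _ => rfl)
  ext c
  simp only [Set.mem_inter_iff, Set.mem_setOf_eq, SimpleGraph.dist_self, zero_add]
  exact ⟨fun h => ⟨h.1.1, h.2⟩, fun h => ⟨⟨h.1, dist_eq_one_iff_adj.2 h.1⟩, h.2⟩⟩

/-- **The count at a LEAF of `F`**: if no child of `v` lies in `F` then `#(Desc v ∩ F ∩ P) = [v ∈ F ∧ P v]`. [cite: Serre1980Trees, I.2.3] [cite: Diestel2010, Prop. 1.5.2] -/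
theorem ncard_setOf_dist_inter_eq_ite_of_forall_child_not_mem (hT : G.IsTree) (r v : V) (F : Set V) [DecidablePred (· ∈ F)] (hFfin : F.Finite)
    (hF : ∀ w ∈ F, w ≠ r → ∀ u, G.Adj w u → G.dist r u + 1 = G.dist r w → u ∈ F) (P : V → Prop) [DecidablePred P]
    (hleaf : ∀ c, G.Adj v c → G.dist r c = G.dist r v + 1 → c ∉ F) :
    ({w | G.dist r w = G.dist r v + G.dist v w} ∩ F ∩ {w | P w}).ncard = if v ∈ F ∧ P v then 1 else 0 := by
  rw [ncard_setOf_dist_inter_eq_add_sum_finset_of_parentClosed hT r v F hFfin hF P ∅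
    (fun c => by simp only [Finset.notMem_empty, false_iff, not_and]; exact hleaf c), Finset.sum_empty, add_zero]

/-- **The `Finset.filter` spelling of (B3)(ii)** (for a Finset `F` of vertices, parent-closed off the root, and a decidable `P`):
`#(F.filter (· ∈ Desc v ∧ P ·)) = [v ∈ F ∧ P v] + Σ_{c ∈ F.filter (child of v)} #(F.filter (· ∈ Desc c ∧ P ·))`. [cite: Serre1980Trees, I.2.3] [cite: Diestel2010, Prop. 1.5.2] -/
theorem card_filter_dist_eq_add_sum_card_filter_of_parentClosed [DecidableEq V] (hT : G.IsTree) (r v : V) (F : Finset V)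
    (hF : ∀ w ∈ F, w ≠ r → ∀ u, G.Adj w u → G.dist r u + 1 = G.dist r w → u ∈ F) (P : V → Prop) [DecidablePred P]
    [DecidablePred (fun c => G.Adj v c)] :
    (F.filter (fun w => G.dist r w = G.dist r v + G.dist v w ∧ P w)).card =
      (if v ∈ F ∧ P v then 1 else 0) +
        ∑ c ∈ F.filter (fun c => G.Adj v c ∧ G.dist r c = G.dist r v + 1), (F.filter (fun w => G.dist r w = G.dist r c + G.dist c w ∧ P w)).card := by
  have hset : ∀ u, ((F.filter (fun w => G.dist r w = G.dist r u + G.dist u w ∧ P w)) : Set V) =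
      {w | G.dist r w = G.dist r u + G.dist u w} ∩ (F : Set V) ∩ {w | P w} := fun u => by
    ext w
    simp only [Finset.coe_filter, Set.mem_setOf_eq, Set.mem_inter_iff, Finset.mem_coe]
    tauto
  have key := ncard_setOf_dist_inter_eq_add_sum_finset_of_parentClosed hT r v (F : Set V) F.finite_toSet
    (fun w hw hwr u hadj hdu => hF w hw hwr u hadj hdu) P (F.filter (fun c => G.Adj v c ∧ G.dist r c = G.dist r v + 1))
    (fun c => by rw [Finset.mem_filter, Finset.mem_coe]; tauto)
  rw [← Set.ncard_coe_finset, hset v, key]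
  congr 1
  exact Finset.sum_congr rfl (fun c _ => by rw [← Set.ncard_coe_finset, hset c])

/-- **Parent-closed ⇒ ancestor-closed**: if `F` is parent-closed off the root and `w ∈ F` descends from `u`, then `u ∈ F`. [cite: Diestel2010, Prop. 1.5.2] -/
theorem mem_of_mem_setOf_dist_of_parentClosed (hT : G.IsTree) (r : V) {F : Set V}
    (hF : ∀ w ∈ F, w ≠ r → ∀ u, G.Adj w u → G.dist r u + 1 = G.dist r w → u ∈ F) {u w : V} (hw : w ∈ F)
    (hwu : w ∈ {x | G.dist r x = G.dist r u + G.dist u x}) : u ∈ F := by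
  obtain ⟨h, p, hdist, h0, hpar, -, hchild, -⟩ :=
    TreeRetraction.exists_retraction hT (Y := ({r} : Set V)) ⟨r, rfl⟩ (connected_induce_singleton r)
  have hh : ∀ v, h v = G.dist r v := height_eq_dist_of_singleton hdist
  have hF' : ∀ w ∈ F, w ∉ ({r} : Set V) → p w ∈ F := fun w hw hwr => by
    obtain ⟨hadj, hhp⟩ := hpar w hwr
    exact hF w hw (fun heq => hwr (Set.mem_singleton_iff.2 heq)) (p w) hadj (by rw [← hh, ← hh, hhp])
  have hwu' : w ∈ {w | h u ≤ h w ∧ p^[h w - h u] w = u} :=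
    (mem_cone_iff_height_eq_add_dist h0 hpar hchild hT.1 hdist u w).2 (by rw [hh, hh]; exact hwu)
  have key := iterate_parent_mem_of_parentClosed h0 hpar hF' hw (h w - h u) (by omega)
  rw [hwu'.2] at key
  exact key

/-- **Ancestor-closed ⇒ parent-closed** (the other spelling of the closure hypothesis implies the one used in this file). [cite: Diestel2010, Prop. 1.5.2] -/
theorem parentClosed_of_ancestorClosed (r : V) {F : Set V} (hF : ∀ w ∈ F, ∀ u, w ∈ {x | G.dist r x = G.dist r u + G.dist u x} → u ∈ F) :
    ∀ w ∈ F, w ≠ r → ∀ u, G.Adj w u → G.dist r u + 1 = G.dist r w → u ∈ F := by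
  intro w hw _ u hadj hdu
  refine hF w hw u ?_
  show G.dist r w = G.dist r u + G.dist u w
  rw [dist_eq_one_iff_adj.2 hadj.symm]
  omega

/-- **An automorphism fixing the root and a vertex fixes all its ancestors** (`Fix φ` is ancestor-closed). [cite: Serre1980Trees, I.6.4 Prop. 24] [cite: Diestel2010, Thm. 1.5.1] -/
theorem iso_apply_eq_self_of_mem_setOf_dist (hT : G.IsTree) (r : V) (φ : G ≃g G) (hφ : φ r = r) {u w : V} (hw : φ w = w)
    (hwu : w ∈ {x | G.dist r x = G.dist r u + G.dist u x}) : φ u = u :=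
  mem_of_mem_setOf_dist_of_parentClosed hT r (F := {v | φ v = v}) (parentClosed_fixedPoints hT r φ hφ) hw hwu

end RootedExtras

/-! ## §6 Transport along a graph isomorphism `φ : G ≃g G′` (J3): distances, descendant sets, children, fixed sets, parent-closedness, the counts -/

section IsoTransport

variable {V' : Type*} {G' : SimpleGraph V'}

/-- A graph isomorphism does not increase the graph distance (a shortest walk maps to a walk of the same length; twin of ★ `Hinz2018.dist_iso_apply`, restated to
avoid that import).  (Mathlib already transports `Reachable`, `Connected`, `IsTree`: `Iso.reachable_iff`, `Iso.connected_iff`, `Iso.isTree_iff`.) [cite: Diestel2010, Thm. 1.5.1] -/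
theorem dist_iso_apply_le (φ : G ≃g G') (u v : V) : G'.dist (φ u) (φ v) ≤ G.dist u v := by
  by_cases hr : G.Reachable u v
  · obtain ⟨p, hp⟩ := hr.exists_walk_length_eq_dist
    rw [← hp, ← SimpleGraph.Walk.length_map φ.toHom p]
    exact SimpleGraph.dist_le _
  · have hr' : ¬ G'.Reachable (φ u) (φ v) := fun h' => hr (SimpleGraph.Iso.reachable_iff.1 h')
    rw [SimpleGraph.dist_eq_zero_of_not_reachable hr, SimpleGraph.dist_eq_zero_of_not_reachable hr']

/-- **Graph distance is invariant under a graph isomorphism**: `dist(φ u, φ v) = dist(u, v)`. [cite: Diestel2010, Thm. 1.5.1] -/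
theorem dist_iso_apply (φ : G ≃g G') (u v : V) : G'.dist (φ u) (φ v) = G.dist u v := by
  refine le_antisymm (dist_iso_apply_le φ u v) ?_
  have h2 := dist_iso_apply_le φ.symm (φ u) (φ v)
  rwa [RelIso.symm_apply_apply, RelIso.symm_apply_apply] at h2

/-- **Descendant sets correspond** (membership form): `φ w ∈ Desc_{φ r}(φ v) ↔ w ∈ Desc_r(v)`. [cite: Serre1980Trees, I.2.3] -/
theorem iso_apply_mem_setOf_dist_iff (φ : G ≃g G') (r v w : V) :
    φ w ∈ {w' | G'.dist (φ r) w' = G'.dist (φ r) (φ v) + G'.dist (φ v) w'} ↔ w ∈ {w | G.dist r w = G.dist r v + G.dist v w} := by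
  simp only [Set.mem_setOf_eq, dist_iso_apply]

/-- **Descendant sets correspond**: `φ(Desc_r(v)) = Desc_{φ r}(φ v)`. [cite: Serre1980Trees, I.2.3] -/
theorem image_setOf_dist_eq_add_dist (φ : G ≃g G') (r v : V) :
    φ '' {w | G.dist r w = G.dist r v + G.dist v w} = {w' | G'.dist (φ r) w' = G'.dist (φ r) (φ v) + G'.dist (φ v) w'} := by
  ext w'
  constructor
  · rintro ⟨w, hw, rfl⟩
    exact (iso_apply_mem_setOf_dist_iff φ r v w).2 hw
  · intro hw'
    refine ⟨φ.symm w', ?_, RelIso.apply_symm_apply φ w'⟩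
    rw [← iso_apply_mem_setOf_dist_iff φ r v, RelIso.apply_symm_apply]
    exact hw'

/-- **Children correspond**: `φ({c ~ v | dist(r,c) = dist(r,v)+1}) = {c′ ~ φ v | dist(φ r, c′) = dist(φ r, φ v)+1}`. [cite: Serre1980Trees, I.2.3] -/
theorem image_setOf_adj_and_dist_eq (φ : G ≃g G') (r v : V) :
    φ '' {c | G.Adj v c ∧ G.dist r c = G.dist r v + 1} = {c' | G'.Adj (φ v) c' ∧ G'.dist (φ r) c' = G'.dist (φ r) (φ v) + 1} := by
  ext c'
  simp only [Set.mem_image, Set.mem_setOf_eq]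
  constructor
  · rintro ⟨c, ⟨hadj, hc⟩, rfl⟩
    exact ⟨φ.map_adj_iff.2 hadj, by rw [dist_iso_apply, dist_iso_apply, hc]⟩
  · rintro ⟨hadj, hc⟩
    refine ⟨φ.symm c', ⟨?_, ?_⟩, RelIso.apply_symm_apply φ c'⟩
    · have h := φ.symm.map_adj_iff.2 hadj
      rwa [RelIso.symm_apply_apply] at h
    · rw [← dist_iso_apply φ, ← dist_iso_apply φ r v, RelIso.apply_symm_apply]
      exact hc

/-- **Counts correspond**: `#φ(S) = #S`. [cite: Diestel2010, Thm. 1.5.1] -/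
theorem ncard_image_iso (φ : G ≃g G') (S : Set V) : (φ '' S).ncard = S.ncard :=
  Set.ncard_image_of_injective S φ.injective

/-- **Fixed sets correspond**: the image of `Fix α` (`α : G ≃g G`) is the fixed set of the conjugate automorphism `φ ∘ α ∘ φ⁻¹ = φ.symm.trans (α.trans φ)` of `G′`.
[cite: Serre1980Trees, I.6.4 Prop. 24] -/
theorem image_setOf_apply_eq_self (φ : G ≃g G') (α : G ≃g G) :
    φ '' {v | α v = v} = {v' | (φ.symm.trans (α.trans φ)) v' = v'} := by
  ext v'
  simp only [Set.mem_image, Set.mem_setOf_eq, RelIso.trans_apply]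
  constructor
  · rintro ⟨v, hv, rfl⟩
    rw [RelIso.symm_apply_apply, hv]
  · intro h
    refine ⟨φ.symm v', ?_, RelIso.apply_symm_apply φ v'⟩
    apply φ.injective
    rw [h, RelIso.apply_symm_apply]

/-- The conjugate automorphism fixes the image of the root. [cite: Serre1980Trees, I.6.4 Prop. 24] -/
theorem conj_apply_eq_self_of_apply_eq_self (φ : G ≃g G') (α : G ≃g G) {r : V} (hr : α r = r) : (φ.symm.trans (α.trans φ)) (φ r) = φ r := by
  simp only [RelIso.trans_apply, RelIso.symm_apply_apply, hr]

/-- **Parent-closedness transports**: if `F` is parent-closed for `(G, r)` then `φ(F)` is parent-closed for `(G′, φ r)`. [cite: Diestel2010, Prop. 1.5.2] -/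
theorem parentClosed_image_iso (φ : G ≃g G') (r : V) {F : Set V}
    (hF : ∀ w ∈ F, w ≠ r → ∀ u, G.Adj w u → G.dist r u + 1 = G.dist r w → u ∈ F) :
    ∀ w' ∈ φ '' F, w' ≠ φ r → ∀ u', G'.Adj w' u' → G'.dist (φ r) u' + 1 = G'.dist (φ r) w' → u' ∈ φ '' F := by
  rintro _ ⟨w, hw, rfl⟩ hwr u' hadj hdu
  refine ⟨φ.symm u', hF w hw (fun h => hwr (by rw [h])) (φ.symm u') ?_ ?_, RelIso.apply_symm_apply φ u'⟩
  · have h := φ.symm.map_adj_iff.2 hadj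
    rwa [RelIso.symm_apply_apply] at h
  · rw [← dist_iso_apply φ, ← dist_iso_apply φ r w, RelIso.apply_symm_apply]
    exact hdu

/-- Finiteness transports: `φ(F)` is finite iff `F` is. [cite: Diestel2010, Thm. 1.5.1] -/
theorem finite_image_iso_iff (φ : G ≃g G') (F : Set V) : (φ '' F).Finite ↔ F.Finite :=
  Set.finite_image_iff φ.injective.injOn

/-- **The counts transport** (any `S`): `#(Desc_{φ r}(φ v) ∩ φ(S)) = #(Desc_r(v) ∩ S)`. [cite: Serre1980Trees, I.2.3] -/
theorem ncard_setOf_dist_inter_image_eq (φ : G ≃g G') (r v : V) (S : Set V) :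
    ({w' | G'.dist (φ r) w' = G'.dist (φ r) (φ v) + G'.dist (φ v) w'} ∩ φ '' S).ncard = ({w | G.dist r w = G.dist r v + G.dist v w} ∩ S).ncard := by
  rw [← image_setOf_dist_eq_add_dist, ← Set.image_inter φ.injective, ncard_image_iso]

/-- **The counts transport** (the `F ∩ P` shape): for predicates `P` on `V` and `P′` on `V′` corresponding under `φ` (`P′ (φ w) ↔ P w`),
`#(Desc_{φ r}(φ v) ∩ φ(F) ∩ P′) = #(Desc_r(v) ∩ F ∩ P)`. [cite: Serre1980Trees, I.2.3] [cite: Diestel2010, Prop. 1.5.2] -/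
theorem ncard_setOf_dist_inter_image_inter_eq (φ : G ≃g G') (r v : V) (F : Set V) (P : V → Prop) (P' : V' → Prop) (hP : ∀ w, P' (φ w) ↔ P w) :
    ({w' | G'.dist (φ r) w' = G'.dist (φ r) (φ v) + G'.dist (φ v) w'} ∩ φ '' F ∩ {w' | P' w'}).ncard =
      ({w | G.dist r w = G.dist r v + G.dist v w} ∩ F ∩ {w | P w}).ncard := by
  have hP' : {w' | P' w'} ∩ Set.range φ = φ '' {w | P w} := by
    ext w'
    constructor
    · rintro ⟨hPw, ⟨w, rfl⟩⟩
      exact ⟨w, (hP w).1 hPw, rfl⟩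
    · rintro ⟨w, hw, rfl⟩
      exact ⟨(hP w).2 hw, ⟨w, rfl⟩⟩
  have hset : {w' | G'.dist (φ r) w' = G'.dist (φ r) (φ v) + G'.dist (φ v) w'} ∩ φ '' F ∩ {w' | P' w'} =
      φ '' ({w | G.dist r w = G.dist r v + G.dist v w} ∩ F ∩ {w | P w}) := by
    rw [Set.image_inter φ.injective, Set.image_inter φ.injective, image_setOf_dist_eq_add_dist, ← hP']
    ext w'
    simp only [Set.mem_inter_iff, Set.mem_range, Set.mem_image]
    constructor
    · rintro ⟨⟨hD, ⟨w, hwF, rfl⟩⟩, hPw⟩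
      exact ⟨⟨hD, ⟨w, hwF, rfl⟩⟩, hPw, ⟨w, rfl⟩⟩
    · rintro ⟨⟨hD, hF⟩, hPw, -⟩
      exact ⟨⟨hD, hF⟩, hPw⟩
  rw [hset, ncard_image_iso]

end IsoTransport

end Literature.Combinatorics.SimpleGraph.TreeLayers
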